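import Literature.Topology.FourManifolds.ExoticSevenSphere
import Literature.Topology.FourManifolds.SmoothPoincareLowDim
import Literature.Topology.FourManifolds.SphereSimplyConnected
import Literature.Topology.FourManifolds.SmoothOrientationProofs
import HarnessLib

/-!
# The smooth Poincaré conjecture fails in dimension `7` iff `Θ₇ ≠ 0` (proofs)

Topic `Literature/Topology/FourManifolds`; pure-proof companion of the wave-0 statement file
`SPC4Wave0.lean` and of `ExoticSevenSphere.lean`. It concerns the named fact
`Literature.Topology.FourManifolds.not_forall_nonemptyDiffeomorphSphere_seven` (**spc4.S32**,
negative part: *the smooth Poincaré conjecture fails in dimension `7`* — not every Hausdorff,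
second countable smooth `7`-manifold homotopy equivalent to `S⁷` is diffeomorphic to `S⁷`), whose
source is Milnor, *On manifolds homeomorphic to the 7-sphere*, Ann. of Math. 64 (1956), Theorem 3
(p. 403): "For `k² ≢ 1 mod 7` the manifold `M⁷ₖ` is homeomorphic to `S⁷` but not diffeomorphic to
`S⁷`." Everything in this file is **proved**; no definition, no new named fact, and no statement
of `SPC4Wave0.lean` is changed.

`ExoticSevenSphere.lean` proves spc4.S12 ⟹ spc4.S32⁻ (`not_forall_nonemptyDiffeomorphSphere_seven_of`)
and, GRANTED the topological Poincaré conjecture in dimensions `≥ 5` (spc4.S14,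
`nonempty_homeomorph_sphere_of_five_le`), the converse and `|Θ₇| = 28 ⟹` spc4.S12, spc4.S32⁻. This
file removes the topological Poincaré hypothesis wherever spc4.S32⁻ (a statement about *homotopy*
spheres) is the target, and supplies the missing converse spc4.S32⁻ ⟹ `Θ₇ ≠ 0`:

## What is proved

* `not_forall_nonemptyDiffeomorphSphere_seven_iff_exists_homotopySphere` — the manifold-level
  form: spc4.S32⁻ iff some oriented homotopy `7`-sphere (`HomotopySphere 7`: a closed, Hausdorff,
  second countable, oriented smooth `7`-manifold homotopy equivalent to `S⁷`) has carrier not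
  diffeomorphic to `S⁷`. (⟹) the offending manifold `M ≃ₕ S⁷` is compact
  (`compactSpace_of_homotopyEquiv_sphere`: a non-compact connected `7`-manifold has
  `H₇ = 0 ≠ H₇(S⁷)`), simply connected (`π₁(S⁷) = 1`) hence orientable
  (`isOrientable_of_simplyConnectedSpace_holds`); (⟸) a homotopy sphere is such a manifold.
* `not_forall_nonemptyDiffeomorphSphere_seven_of_nontrivial` — `Θ₇ ≠ 0 ⟹` spc4.S32⁻, with NO
  topological Poincaré hypothesis: if every Hausdorff second countable smooth `7`-manifold homotopy
  equivalent to `S⁷` were diffeomorphic to `S⁷`, then in particular every homotopy `7`-sphere would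
  be, and `Θ₇` would be a point (the tree's
  `HomotopySphereClass.subsingleton_of_nonempty_diffeomorph_sphere`, Kervaire–Milnor 1963, §2).
* `nontrivial_homotopySphereClass_seven_of_not_forall` — spc4.S32⁻ `⟹ Θ₇ ≠ 0`: the class of
  the homotopy sphere `Σ` just obtained differs from `[S⁷, o₀]`, since equal classes are
  oriented-diffeomorphic (`HomotopySphereClass.exact`).
* `not_forall_nonemptyDiffeomorphSphere_seven_iff_nontrivial` — **spc4.S32⁻ ⟺ `Θ₇` is nontrivial**.
* `not_forall_nonemptyDiffeomorphSphere_seven_of_natCard_homotopySphereClass_seven` — spc4.S13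
  (`|Θ₇| = 28`, `natCard_homotopySphereClass_seven`, Kervaire–Milnor 1963, table p. 504) ⟹ spc4.S32⁻,
  again without the topological Poincaré hypothesis of
  `not_forall_nonemptyDiffeomorphSphere_seven_of_natCard` (`ExoticSevenSphere.lean`).
* `nontrivial_homotopySphereClass_seven_of_exists_homeomorph` — spc4.S12 (Milnor's theorem in
  Mathlib's `proof_wanted` form) `⟹ Θ₇ ≠ 0` (Kervaire–Milnor 1963, p. 504: Milnor [1956] showed
  `Θ₇ ≠ 0`), and `exists_homeomorph_isEmpty_diffeomorph_sphere_seven_iff_nontrivial` — granted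
  spc4.S14, spc4.S12 ⟺ `Θ₇ ≠ 0`.

So the trust base of spc4.S32⁻ is any one of: spc4.S12 (Milnor 1956, Thm. 3), spc4.S13
(Kervaire–Milnor 1963), or any other proof that `Θ₇` has two elements.

## Status of the discharge (plan of the deeper layers; not formalised)

`not_forall_nonemptyDiffeomorphSphere_seven_holds` is NOT proved here. Milnor's printed proof of
Theorem 3 has two halves. (a) `M⁷ₖ` (the `S³`-bundle over `S⁴` with clutching map
`u ↦ (v ↦ uʰ v uʲ)`, `h + j = 1`, `h - j = k`) carries a smooth function with exactly two critical
points, both non-degenerate (Lemma 5, p. 403), hence is homeomorphic to `S⁷` by Reeb's sphere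
theorem (Thm. 2, p. 401) — the tree's named fact `nonempty_homeomorph_sphere_of_ncard_criticalSet_eq_two`
(`Morse.lean`; proved in the tree for `n = 2` only, `MorseTwoCriticalPoints.lean`, next to the
general twisted-sphere conclusion `IsMorse.exists_isTwistedSphere_of_ncard_criticalSet_eq_two`);
for spc4.S32⁻ itself only "homotopy equivalent to `S⁷`" is needed from half (a). (b) `M⁷ₖ` is not
diffeomorphic to `S⁷` for `k² ≢ 1 mod 7` because Milnor's invariant `λ(M⁷ₖ) ≡ k² - 1 (mod 7)` is
non-zero (Lemma 4 with Thm. 1 and Cor. 1, pp. 399–403): this needs Pontryagin classes and numbers,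
the signature of `8`-manifolds with boundary, Thom's `Ω₇ = 0` and Hirzebruch's signature theorem
`τ(C⁸) = (7 p₂ - p₁²)/45`, none of which exists in Mathlib or in the tree, not even as statements.

## References

* J. Milnor, *On manifolds homeomorphic to the 7-sphere*, Ann. of Math. 64 (1956), 399–405:
  Thm. 1 and Cor. 1 (p. 399), Thm. 2 (p. 401), Lemmas 3–5 and Thm. 3 (pp. 402–403).
  doi:10.2307/1969983 [Milnor1956]
* M. Kervaire, J. Milnor, *Groups of homotopy spheres I*, Ann. of Math. 77 (1963), Thm. 1.2 and
  table p. 504 (`Θ₇ : 28`), §1–2 pp. 504–507. [KervaireMilnorAnnals1963]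
* S. Smale, *Generalized Poincaré's conjecture in dimensions greater than four*, Ann. of Math. 74
  (1961), 391–406, Thm. A (p. 391): a closed `C^∞` manifold of the homotopy type of `Sⁿ`, `n ≥ 5`,
  is homeomorphic to `Sⁿ`. doi:10.2307/1970239 [SmalePoincare1961]
-/

open scoped Manifold ContDiff Topology ContinuousMap
open Set Function

noncomputable section

namespace Literature.Topology.FourManifolds

/-! ### spc4.S32⁻ ⟺ some homotopy `7`-sphere is not diffeomorphic to `S⁷` -/

/-- **A homotopy `7`-sphere not diffeomorphic to `S⁷` refutes the smooth Poincaré conjecture in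
dimension `7`**: its carrier is a Hausdorff second countable smooth `7`-manifold homotopy
equivalent to `S⁷` (Kervaire–Milnor 1963, §1: homotopy spheres are closed smooth manifolds of the
homotopy type of `Sⁿ`). [cite: KervaireMilnorAnnals1963, §1 (p. 504)] -/
theorem not_forall_nonemptyDiffeomorphSphere_seven_of_homotopySphere (S : HomotopySphere 7)
    (hS : IsEmpty
      (S.carrier ≃ₘ⟮𝓡 7, 𝓡 7⟯ (Metric.sphere (0 : EuclideanSpace ℝ (Fin 8)) 1))) :
    not_forall_nonemptyDiffeomorphSphere_seven := by
  intro H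
  obtain ⟨e⟩ := S.nonempty_homotopyEquiv
  exact hS.false (H S.carrier S.chartedSpace S.isManifold e).some

/-- **A counterexample to the smooth Poincaré conjecture in dimension `7` is a homotopy sphere.**
If some Hausdorff second countable smooth `7`-manifold `M ≃ₕ S⁷` is not diffeomorphic to `S⁷`, then
some oriented homotopy `7`-sphere has carrier not diffeomorphic to `S⁷`, namely `M` itself: `M` is
compact (`compactSpace_of_homotopyEquiv_sphere`: a non-compact connected `7`-manifold has
`H₇ = 0 ≠ H₇(S⁷)`), simply connected (`π₁(S⁷) = 1`, `simplyConnectedSpace_euclideanSphere`, and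
homotopy invariance) and therefore orientable (`isOrientable_of_simplyConnectedSpace_holds`).
Kervaire–Milnor 1963, §1 (homotopy spheres; every homotopy sphere is orientable, being simply
connected for `n ≥ 2`). [cite: KervaireMilnorAnnals1963, §1 (p. 504)] -/
theorem exists_homotopySphere_isEmpty_diffeomorph_of_not_forall
    (h : not_forall_nonemptyDiffeomorphSphere_seven) :
    ∃ S : HomotopySphere 7,
      IsEmpty
        (S.carrier ≃ₘ⟮𝓡 7, 𝓡 7⟯ (Metric.sphere (0 : EuclideanSpace ℝ (Fin 8)) 1)) := by
  by_contra hne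
  apply h
  intro M _ _ _ _c _i e
  haveI : CompactSpace M := compactSpace_of_homotopyEquiv_sphere (n := 7) (by norm_num) M e
  haveI := simplyConnectedSpace_euclideanSphere (n := 7) (by norm_num)
  haveI : SimplyConnectedSpace M := e.simplyConnectedSpace
  obtain ⟨o⟩ :=
    (isOrientable_of_simplyConnectedSpace_holds (I := 𝓡 7) (M := M) : IsOrientable (𝓡 7) M)
  by_contra hM
  exact hne ⟨⟨M, o, ⟨e⟩⟩, not_nonempty_iff.mp hM⟩

/-- **spc4.S32⁻, manifold-level form**: the smooth Poincaré conjecture fails in dimension `7` iff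
some oriented homotopy `7`-sphere (a closed oriented smooth `7`-manifold homotopy equivalent to
`S⁷`, `HomotopySphere 7`) is not diffeomorphic to `S⁷` — i.e. iff Milnor's phenomenon occurs among
Kervaire–Milnor's homotopy spheres (Kervaire–Milnor 1963, §1, p. 504).
[cite: KervaireMilnorAnnals1963, §1 (p. 504)] -/
theorem not_forall_nonemptyDiffeomorphSphere_seven_iff_exists_homotopySphere :
    not_forall_nonemptyDiffeomorphSphere_seven ↔
      ∃ S : HomotopySphere 7,
        IsEmpty
          (S.carrier ≃ₘ⟮𝓡 7, 𝓡 7⟯ (Metric.sphere (0 : EuclideanSpace ℝ (Fin 8)) 1)) :=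
  ⟨exists_homotopySphere_isEmpty_diffeomorph_of_not_forall,
    fun ⟨S, hS⟩ => not_forall_nonemptyDiffeomorphSphere_seven_of_homotopySphere S hS⟩

/-! ### spc4.S32⁻ ⟺ `Θ₇` is nontrivial -/

/-- **If `Θ₇` is nontrivial, the smooth Poincaré conjecture fails in dimension `7`** (no
topological Poincaré hypothesis). If there are two oriented homotopy `7`-spheres which are not
oriented-diffeomorphic, then some Hausdorff second countable smooth `7`-manifold homotopy equivalent
to `S⁷` is not diffeomorphic to `S⁷`: otherwise every homotopy `7`-sphere `Σ` (a closed such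
manifold with an orientation) is diffeomorphic to `S⁷`, and then `[Σ] = [S⁷, ±o₀] = [S⁷, o₀]`
(`HomotopySphereClass.subsingleton_of_nonempty_diffeomorph_sphere`; Kervaire–Milnor 1963, §2, p. 505
and p. 507: for `n ≠ 3, 4`, `Θₙ = 0` iff every homotopy `n`-sphere is diffeomorphic to `Sⁿ`).
[cite: KervaireMilnorAnnals1963, §2 pp. 505–507] -/
theorem not_forall_nonemptyDiffeomorphSphere_seven_of_nontrivial
    (h : Nontrivial (HomotopySphereClass 7)) : not_forall_nonemptyDiffeomorphSphere_seven := by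
  intro H
  have hsub : Subsingleton (HomotopySphereClass 7) :=
    HomotopySphereClass.subsingleton_of_nonempty_diffeomorph_sphere (by norm_num) fun S => by
      obtain ⟨e⟩ := S.nonempty_homotopyEquiv
      exact H S.carrier S.chartedSpace S.isManifold e
  exact (not_subsingleton_iff_nontrivial.mpr h) hsub

/-- **If the smooth Poincaré conjecture fails in dimension `7`, then `Θ₇` is nontrivial.** By
`exists_homotopySphere_isEmpty_diffeomorph_of_not_forall` some oriented homotopy `7`-sphere `Σ` is
not diffeomorphic to `S⁷`; then `[Σ] ≠ [S⁷, o₀]` in `Θ₇`, since equal classes are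
oriented-diffeomorphic (`HomotopySphereClass.exact`). Kervaire–Milnor 1963, §1–2 (`Θₙ` as the set
of diffeomorphism classes of homotopy spheres, p. 505).
[cite: KervaireMilnorAnnals1963, §1–2 (p. 505)] -/
theorem nontrivial_homotopySphereClass_seven_of_not_forall
    (h : not_forall_nonemptyDiffeomorphSphere_seven) : Nontrivial (HomotopySphereClass 7) := by
  obtain ⟨S, hS⟩ := exists_homotopySphere_isEmpty_diffeomorph_of_not_forall h
  obtain ⟨o₀⟩ := (isOrientable_sphere_holds 7 : Nonempty _)
  refine ⟨⟨HomotopySphereClass.mk S, HomotopySphereClass.mk (HomotopySphere.sphere o₀), ?_⟩⟩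
  intro hST
  obtain ⟨φ, -⟩ := HomotopySphereClass.exact hST
  exact hS.false φ

/-- **spc4.S32⁻ ⟺ `Θ₇ ≠ 0`.** The smooth Poincaré conjecture fails in dimension `7` (not every
Hausdorff second countable smooth `7`-manifold homotopy equivalent to `S⁷` is diffeomorphic to
`S⁷`) if and only if Kervaire–Milnor's `Θ₇ = HomotopySphereClass 7` — oriented homotopy
`7`-spheres modulo orientation-preserving diffeomorphism — is nontrivial (Kervaire–Milnor 1963,
§1–2, p. 505; the value `Θ₇ ≅ ℤ₂₈` is the table p. 504, Milnor 1956 giving the first non-zero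
element). [cite: KervaireMilnorAnnals1963, §1–2 (p. 505) and table p. 504] -/
theorem not_forall_nonemptyDiffeomorphSphere_seven_iff_nontrivial :
    not_forall_nonemptyDiffeomorphSphere_seven ↔ Nontrivial (HomotopySphereClass 7) :=
  ⟨nontrivial_homotopySphereClass_seven_of_not_forall,
    not_forall_nonemptyDiffeomorphSphere_seven_of_nontrivial⟩

/-! ### spc4.S13 ⟹ spc4.S32⁻ and spc4.S12 ⟹ `Θ₇ ≠ 0` -/

/-- **`|Θ₇| = 28` refutes the smooth Poincaré conjecture in dimension `7`** (no topological
Poincaré hypothesis, unlike `not_forall_nonemptyDiffeomorphSphere_seven_of_natCard`). Kervaire–Milnor's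
count of the oriented diffeomorphism classes of homotopy `7`-spheres (spc4.S13,
`natCard_homotopySphereClass_seven`; *Groups of homotopy spheres I* (1963), Thm. 1.2 and table
p. 504) makes `Θ₇` nontrivial (`nontrivial_homotopySphereClass_seven_of`), hence spc4.S32⁻.
[cite: KervaireMilnorAnnals1963, Thm. 1.2 and table p. 504] -/
theorem not_forall_nonemptyDiffeomorphSphere_seven_of_natCard_homotopySphereClass_seven
    (h : natCard_homotopySphereClass_seven) : not_forall_nonemptyDiffeomorphSphere_seven :=
  not_forall_nonemptyDiffeomorphSphere_seven_of_nontrivial (nontrivial_homotopySphereClass_seven_of h)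

/-- **Milnor's theorem makes `Θ₇` nontrivial**: an exotic `7`-sphere in the sense of spc4.S12
(a smooth `7`-manifold homeomorphic but not diffeomorphic to `S⁷`; Milnor 1956, Thm. 3) yields two
distinct elements of `Θ₇` (Kervaire–Milnor 1963, p. 504: "Milnor [15] showed that `Θ₇ ≠ 0`";
through `not_forall_nonemptyDiffeomorphSphere_seven_of` of `ExoticSevenSphere.lean`).
[cite: Milnor1956, Thm. 3 (p. 403)] -/
theorem nontrivial_homotopySphereClass_seven_of_exists_homeomorph
    (h : exists_homeomorph_isEmpty_diffeomorph_sphere_seven) : Nontrivial (HomotopySphereClass 7) :=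
  nontrivial_homotopySphereClass_seven_of_not_forall (not_forall_nonemptyDiffeomorphSphere_seven_of h)

/-- **Granted the topological Poincaré conjecture in dimensions `≥ 5` (spc4.S14; Smale 1961, Thm. A
for smooth manifolds), an exotic `7`-sphere exists (spc4.S12, Milnor 1956, Thm. 3) iff `Θ₇` is
nontrivial** (`exists_homeomorph_isEmpty_diffeomorph_sphere_seven_of_nontrivial`,
`ExoticSevenSphere.lean`, and `nontrivial_homotopySphereClass_seven_of_exists_homeomorph`).
[cite: SmalePoincare1961, Thm. A (p. 391)] -/
theorem exists_homeomorph_isEmpty_diffeomorph_sphere_seven_iff_nontrivial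
    (hTop : nonempty_homeomorph_sphere_of_five_le.{0}) :
    exists_homeomorph_isEmpty_diffeomorph_sphere_seven ↔ Nontrivial (HomotopySphereClass 7) :=
  ⟨nontrivial_homotopySphereClass_seven_of_exists_homeomorph,
    fun h => exists_homeomorph_isEmpty_diffeomorph_sphere_seven_of_nontrivial h hTop⟩

end Literature.Topology.FourManifolds

end
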